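import Mathlib
import Summits.Ventures.LatticeQCDFlow.TrivializingMaps.TruncatedFlowReceptiveField
import Summits.Ventures.LatticeQCDFlow.TrivializingMaps.FiniteRangeDecorrelation
import Summits.Ventures.LatticeQCDFlow.TrivializingMaps.QuasiLocalDecorrelation
import Summits.Ventures.LatticeQCDFlow.TrivializingMaps.LightConeProfileDecay
import HarnessLib

/-!
HONEST FRAMING: exact (Metropolis-corrected) sampling algorithms for lattice gauge theory; figures
of merit are autocorrelation/cost numbers at stated couplings and volumes; no continuum-physics
claim.

# TruncatedFlowDecorrelation — connected correlators of the ORDER-`N` FLOW PROPOSAL LAW decay like the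
# light-cone tail, every volume (PROPOSITION R′ of `QuasiLocalDecorrelation` fed by the receptive-field
# theorem; THEORY-1.md §13.5, §20.2, §26.6 R-T1-82; cell pub-lqcd, lean-2 GEN-5)

The proposal law of the cell's samplers of record (S3/S4) is `q_t = (Φ_t)_* D[V]`: Haar-distributed links
pushed through a flow map `Φ_t` of Lüscher's order-`N` truncated generator `-∂S̃^{[N]}_t`
(`TruncatedWilsonFlowSampler.lean`; `t = 1` there).  PROPOSITION R (`FiniteRangeDecorrelation`) says a
STRICTLY local map of i.i.d. links decorrelates separated observables EXACTLY; PROPOSITION R′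
(`QuasiLocalDecorrelation`) turns an approximation of `Φ` by a strictly local `Ψ` into a covariance
bound.  The receptive-field theorem (`TruncatedFlowReceptiveField`) supplies exactly such a `Ψ` — the
range-`2(N+1)·m` localization of `Φ_t`, with per-link error `ε_m(t) = 2n e^{ct}(ct)^m/m!`,
`c = coneRate d n B β T N` volume-free.  Hence:

**`truncatedFlow_abs_cov_le`** — for `n ≠ 0`, `T ≥ 0`, `t ∈ [0, T]`, every `L`, every smooth solution of
Lüscher's recursion for `β·S_W`, every MEASURABLE flow map `Φ_t` of `-∂S̃^{[N]}_t`, every `m`, and all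
bounded measurable observables `A` (`|A| ≤ a`, supported on the links `S`, sup-Lipschitz constant `ℓ_A`
in the Frobenius distance of the links of `S`) and `B` (`b`, `T'`, `ℓ_B`) whose supports are
`m`-SEPARATED in the read-set graph (the plaquette balls `linkBall (2(N+1)m) e`, `e ∈ S`, are disjoint
from those about `T'`):

  `|E_{q_t}[A B] - E_{q_t}[A] E_{q_t}[B]| ≤ 2 (ℓ_A b + a ℓ_B) · 2n e^{ct}(ct)^m/m!`.

So the connected two-point functions of the order-`N` flow proposal law decay SUPER-EXPONENTIALLY in the
read-set separation `m` beyond `m ≈ e·c·t`, UNIFORMLY IN THE VOLUME (`truncatedFlow_abs_cov_le_uniform`: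
`∃ c ≥ 0, ∀ L, …`); a target with longer-ranged correlations is reached only through the
Metropolis–Hastings reweighting, never by the map alone (PROPOSITION R′'s reading).  §3: the flow of
record is measurable (`exists_isFlowMap_measurable`, non-vacuity).  §4: the contrapositive as an
EXPRESSIVITY BARRIER (`truncatedFlow_abs_cov_target_le`): ANY law `π` that is `ε`-close in the dual sense
(`IntegralClose`) to the order-`N` flow proposal has `|Cov_π(A,B)| ≤ 3εab + 2(ℓ_A b + a ℓ_B)ε_m(t)`
across read-set separation `m`.  §5: explicit depth with theory-1's row 84 (`LightConeProfileDecay`):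
`truncatedFlow_receptiveDepth` (the range-`2(N+1)·⌈max(e²ct, ct + log(2n/ε))⌉₊` localization is within
`ε` of `Φ_t` per link) and `truncatedFlow_abs_cov_le_of_depth`.

NOT claimed: any bound on the reweighting cost / ESS / acceptance; any statement about `π_β` itself.

References: M. Lüscher, Commun. Math. Phys. 293 (2010) 899 [Luscher2010Trivializing], §3.2, §4.1,
§4.5(b)(c); THEORY-1.md §13.5, §20.2, §26.
-/

noncomputable section

namespace Summit.Ventures.LatticeQCDFlow.TrivializingMaps

open MeasureTheory
open Literature.MathematicalPhysics.QuantumFieldTheory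
open Literature.MathematicalPhysics.QuantumFieldTheory.Luscher2010
open Literature.MathematicalPhysics.QuantumFieldTheory.WilsonFlow (coeConfig)
open scoped Matrix Matrix.Norms.Frobenius Nat ContDiff

variable {d L n : ℕ}

/-! ## §1. Measurability of freezing and localization; disjoint read-closures from separated balls -/

section Plumbing

variable {G : Type*} [MeasurableSpace G]

/-- Freezing outside a set of links is measurable in the field. [ours] -/
theorem measurable_freezeOutside (S : Set (Edge d L)) (V₀ : GaugeConfig d L G) :
    Measurable (freezeOutside S V₀) := by
  classical
  refine measurable_pi_iff.2 fun e => ?_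
  by_cases he : e ∈ S
  · simp only [freezeOutside, he, if_true]
    exact measurable_pi_apply e
  · simp only [freezeOutside, he, if_false]
    exact measurable_const

/-- The localization of a measurable field map is measurable. [ours] -/
theorem measurable_localize (R m : ℕ) (V₀ : GaugeConfig d L G) {F : GaugeConfig d L G → GaugeConfig d L G}
    (hF : Measurable F) : Measurable (localize R m V₀ F) := by
  refine measurable_pi_iff.2 fun e => ?_
  exact (measurable_pi_apply e).comp (hF.comp (measurable_freezeOutside _ V₀))

omit [MeasurableSpace G] in
/-- Pairwise-disjoint read balls give disjoint read-closures. [ours] -/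
theorem disjoint_readClosure_of_pairwise {N : Edge d L → Set (Edge d L)} {S T : Set (Edge d L)}
    (h : ∀ e ∈ S, ∀ e' ∈ T, Disjoint (N e) (N e')) :
    Disjoint (readClosure N S) (readClosure N T) := by
  rw [Set.disjoint_left]
  intro k hkS hkT
  obtain ⟨e, he, hke⟩ := mem_readClosure.1 hkS
  obtain ⟨e', he', hke'⟩ := mem_readClosure.1 hkT
  exact Set.disjoint_left.1 (h e he e' he') hke hke'

end Plumbing

/-! ## §2. Covariance decay of the order-`N` flow proposal law -/

section Decorrelation

variable [NeZero L]

/-- **CONNECTED CORRELATORS OF THE ORDER-`N` FLOW PROPOSAL LAW DECAY LIKE THE LIGHT-CONE TAIL.**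
For `n ≠ 0`, `T ≥ 0`, `t ∈ [0, T]`, every smooth solution of Lüscher's recursion for `β·S_W`, every
measurable flow map `Φ_t` of `-∂S̃^{[N]}_t`, every `m`, and bounded measurable observables `A`, `B` of the
output field — `|A| ≤ a` supported on `S` with `|A(U) - A(U')| ≤ ℓ_A·η` whenever the links of `S` are
`η`-close in Frobenius norm, `B` likewise with `b, T', ℓ_B` — whose plaquette balls of radius `2(N+1)·m`
are disjoint (`S`, `T'` are `m`-separated in the read-set graph): under `q_t = (Φ_t)_* D[V]`,
`|E[A B] - E[A] E[B]| ≤ 2 (ℓ_A ε b + a ℓ_B ε)`, `ε = 2n e^{ct}(ct)^m/m!`, `c = coneRate d n B β T N`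
(volume-free). [ours; cf. Luscher2010Trivializing §3.2, §4.5(b)] -/
theorem truncatedFlow_abs_cov_le (hn : n ≠ 0) (B : SuBasis n) (β : ℝ) (N : ℕ) {T : ℝ} (hT : 0 ≤ T)
    {Sk : ℕ → AmbConfig d L n → ℝ} {c : ℕ → ℝ} (hsm : ∀ k, ContDiff ℝ ∞ (Sk k))
    (hser : IsLuscherSeries B (fun W => β * ambWilsonAction W) Sk c)
    {Φ : ℝ → GaugeConfig d L (Matrix.specialUnitaryGroup (Fin n) ℂ) →
      GaugeConfig d L (Matrix.specialUnitaryGroup (Fin n) ℂ)}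
    (hΦ : IsFlowMap (fun t W => -linkGrad B (truncFlowAction Sk t N) W) Φ)
    {t : ℝ} (ht : t ∈ Set.Icc 0 T) (hΦm : Measurable (Φ t)) (m : ℕ)
    {A Bo : GaugeConfig d L (Matrix.specialUnitaryGroup (Fin n) ℂ) → ℝ}
    (hAm : Measurable A) (hBm : Measurable Bo) {a b : ℝ} (hAa : ∀ U, |A U| ≤ a) (hBb : ∀ U, |Bo U| ≤ b)
    {S T' : Set (Edge d L)} (hA : DependsOn A S) (hB : DependsOn Bo T') {ℓA ℓB : ℝ}
    (hAlip : ∀ (U U' : GaugeConfig d L (Matrix.specialUnitaryGroup (Fin n) ℂ)) (η : ℝ),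
      (∀ e ∈ S, ‖coeConfig U e - coeConfig U' e‖ ≤ η) → |A U - A U'| ≤ ℓA * η)
    (hBlip : ∀ (U U' : GaugeConfig d L (Matrix.specialUnitaryGroup (Fin n) ℂ)) (η : ℝ),
      (∀ e ∈ T', ‖coeConfig U e - coeConfig U' e‖ ≤ η) → |Bo U - Bo U'| ≤ ℓB * η)
    (hsep : ∀ e ∈ S, ∀ e' ∈ T',
      Disjoint (linkBall (2 * (N + 1) * m) e) (linkBall (2 * (N + 1) * m) e')) :
    |∫ U, A U * Bo U ∂(trivialMeasure (Matrix.specialUnitaryGroup (Fin n) ℂ) d L).map (Φ t) -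
        (∫ U, A U ∂(trivialMeasure (Matrix.specialUnitaryGroup (Fin n) ℂ) d L).map (Φ t)) *
          ∫ U, Bo U ∂(trivialMeasure (Matrix.specialUnitaryGroup (Fin n) ℂ) d L).map (Φ t)| ≤
      2 * (ℓA * (2 * n * Real.exp (coneRate d n B β T N * t) * (coneRate d n B β T N * t) ^ m / (m ! : ℝ))
          * b +
        a * (ℓB * (2 * n * Real.exp (coneRate d n B β T N * t) *
          (coneRate d n B β T N * t) ^ m / (m ! : ℝ)))) := by
  -- the strictly local approximant: the range-`2(N+1)m` localization of `Φ t`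
  set Ψ := localize (2 * (N + 1)) m (fun _ => (1 : Matrix.specialUnitaryGroup (Fin n) ℂ)) (Φ t) with hΨ
  set ε := 2 * n * Real.exp (coneRate d n B β T N * t) * (coneRate d n B β T N * t) ^ m / (m ! : ℝ)
    with hε
  have hΨm : Measurable Ψ := measurable_localize _ m _ hΦm
  have hΨdep : ∀ e, DependsOn (fun V => Ψ V e) (linkBall (2 * (N + 1) * m) e) :=
    fun e => localize_dependsOn _ m _ _ e
  have hclose : ∀ V e, ‖coeConfig (Φ t V) e - coeConfig (Ψ V) e‖ ≤ ε := fun V e =>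
    truncatedFlow_receptiveField hn B β N hT hsm hser hΦ _ m V e t ht
  have hδA : ∀ V, |A (Φ t V) - A (Ψ V)| ≤ ℓA * ε := fun V =>
    hAlip (Φ t V) (Ψ V) ε fun e _ => hclose V e
  have hδB : ∀ V, |Bo (Φ t V) - Bo (Ψ V)| ≤ ℓB * ε := fun V =>
    hBlip (Φ t V) (Ψ V) ε fun e _ => hclose V e
  have hdisj : Disjoint (readClosure (fun e => linkBall (2 * (N + 1) * m) e) S)
      (readClosure (fun e => linkBall (2 * (N + 1) * m) e) T') :=
    disjoint_readClosure_of_pairwise hsep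
  -- unfold the trivial theory as the product Haar law and push the integrals back to `D[V]`
  have htriv : trivialMeasure (Matrix.specialUnitaryGroup (Fin n) ℂ) d L =
      Measure.pi fun _ : Edge d L => haarProbability (Matrix.specialUnitaryGroup (Fin n) ℂ) := rfl
  rw [htriv]
  set μ := Measure.pi fun _ : Edge d L => haarProbability (Matrix.specialUnitaryGroup (Fin n) ℂ) with hμ
  have hABm : AEStronglyMeasurable (fun U => A U * Bo U) (μ.map (Φ t)) :=
    (hAm.mul hBm).aestronglyMeasurable
  rw [integral_map hΦm.aemeasurable hABm, integral_map hΦm.aemeasurable hAm.aestronglyMeasurable,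
    integral_map hΦm.aemeasurable hBm.aestronglyMeasurable]
  -- the localization decorrelates EXACTLY (PROPOSITION R, `μ` picture)
  have h0 : ∫ V, A (Ψ V) * Bo (Ψ V) ∂μ - (∫ V, A (Ψ V) ∂μ) * ∫ V, Bo (Ψ V) ∂μ = 0 :=
    sub_eq_zero.2 (integral_mul_eq_of_dependsOn_sets
      (haarProbability (Matrix.specialUnitaryGroup (Fin n) ℂ)) hdisj (hAm.comp hΨm) (hBm.comp hΨm)
      (DependsOn.comp_fieldMap hΨdep hA) (DependsOn.comp_fieldMap hΨdep hB))
  have := abs_cov_sub_cov_le μ (f := fun V => A (Φ t V)) (f' := fun V => A (Ψ V))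
    (g := fun V => Bo (Φ t V)) (g' := fun V => Bo (Ψ V)) (hAm.comp hΦm) (hAm.comp hΨm)
    (hBm.comp hΦm) (hBm.comp hΨm) (fun V => hAa _) (fun V => hAa _) (fun V => hBb _)
    (fun V => hBb _) hδA hδB
  rwa [h0, sub_zero] at this

end Decorrelation

/-! ## §3. Volume-uniformity by quantifier order; non-vacuity -/

/-- **COVARIANCE DECAY OF THE ORDER-`N` FLOW PROPOSAL LAW, ONE RATE FOR ALL VOLUMES.**  For `n ≠ 0`,
`T ≥ 0` and fixed `d, B, β, N` there is ONE `c ≥ 0` such that FOR EVERY `L` the conclusion of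
`truncatedFlow_abs_cov_le` holds with `ε = 2n e^{ct}(ct)^m/m!`. [ours] -/
theorem truncatedFlow_abs_cov_le_uniform (d : ℕ) {n : ℕ} (hn : n ≠ 0) (B : SuBasis n) (β : ℝ)
    (N : ℕ) {T : ℝ} (hT : 0 ≤ T) :
    ∃ c : ℝ, 0 ≤ c ∧ ∀ (L : ℕ) [NeZero L] (Sk : ℕ → AmbConfig d L n → ℝ) (cs : ℕ → ℝ),
      (∀ k, ContDiff ℝ ∞ (Sk k)) → IsLuscherSeries B (fun W => β * ambWilsonAction W) Sk cs →
      ∀ (Φ : ℝ → GaugeConfig d L (Matrix.specialUnitaryGroup (Fin n) ℂ) →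
          GaugeConfig d L (Matrix.specialUnitaryGroup (Fin n) ℂ)),
        IsFlowMap (fun t W => -linkGrad B (truncFlowAction Sk t N) W) Φ →
      ∀ t ∈ Set.Icc 0 T, Measurable (Φ t) → ∀ (m : ℕ)
        (A Bo : GaugeConfig d L (Matrix.specialUnitaryGroup (Fin n) ℂ) → ℝ),
        Measurable A → Measurable Bo → ∀ (a b : ℝ), (∀ U, |A U| ≤ a) → (∀ U, |Bo U| ≤ b) →
        ∀ (S T' : Set (Edge d L)), DependsOn A S → DependsOn Bo T' → ∀ (ℓA ℓB : ℝ),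
        (∀ (U U' : GaugeConfig d L (Matrix.specialUnitaryGroup (Fin n) ℂ)) (η : ℝ),
          (∀ e ∈ S, ‖coeConfig U e - coeConfig U' e‖ ≤ η) → |A U - A U'| ≤ ℓA * η) →
        (∀ (U U' : GaugeConfig d L (Matrix.specialUnitaryGroup (Fin n) ℂ)) (η : ℝ),
          (∀ e ∈ T', ‖coeConfig U e - coeConfig U' e‖ ≤ η) → |Bo U - Bo U'| ≤ ℓB * η) →
        (∀ e ∈ S, ∀ e' ∈ T',
          Disjoint (linkBall (2 * (N + 1) * m) e) (linkBall (2 * (N + 1) * m) e')) →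
        |∫ U, A U * Bo U ∂(trivialMeasure (Matrix.specialUnitaryGroup (Fin n) ℂ) d L).map (Φ t) -
            (∫ U, A U ∂(trivialMeasure (Matrix.specialUnitaryGroup (Fin n) ℂ) d L).map (Φ t)) *
              ∫ U, Bo U ∂(trivialMeasure (Matrix.specialUnitaryGroup (Fin n) ℂ) d L).map (Φ t)| ≤
          2 * (ℓA * (2 * n * Real.exp (c * t) * (c * t) ^ m / (m ! : ℝ)) * b +
            a * (ℓB * (2 * n * Real.exp (c * t) * (c * t) ^ m / (m ! : ℝ)))) :=
  ⟨coneRate d n B β T N, coneRate_nonneg d n B β hT N,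
    fun _L _ _Sk _cs hsm hser _Φ hΦ _t ht hΦm m _A _Bo hAm hBm _a _b hAa hBb _S _T' hA hB _ℓA _ℓB
        hAlip hBlip hsep =>
      truncatedFlow_abs_cov_le hn B β N hT hsm hser hΦ ht hΦm m hAm hBm hAa hBb hA hB hAlip hBlip hsep⟩

/-- **Non-vacuity: the flow of record is measurable at every time.**  For every smooth solution there is
a jointly continuous flow map `Φ` of `-∂S̃^{[N]}_t` (tree `exists_isFlowMap_truncFlowAction`), and each
`Φ_t` is measurable — so `truncatedFlow_abs_cov_le` applies to it at every `t ∈ [0, T]`. [ours] -/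
theorem exists_isFlowMap_measurable [NeZero L] (B : SuBasis n) {Sk : ℕ → AmbConfig d L n → ℝ}
    (hsm : ∀ k, ContDiff ℝ ∞ (Sk k)) (N : ℕ) :
    ∃ Φ : ℝ → GaugeConfig d L (Matrix.specialUnitaryGroup (Fin n) ℂ) →
        GaugeConfig d L (Matrix.specialUnitaryGroup (Fin n) ℂ),
      IsFlowMap (fun t W => -linkGrad B (truncFlowAction Sk t N) W) Φ ∧ ∀ t, Measurable (Φ t) := by
  haveI : SecondCountableTopology (Matrix (Fin n) (Fin n) ℂ) :=
    inferInstanceAs (SecondCountableTopology (Fin n → Fin n → ℂ))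
  haveI : SecondCountableTopology (Matrix.specialUnitaryGroup (Fin n) ℂ) :=
    Topology.IsEmbedding.subtypeVal.secondCountableTopology
  obtain ⟨Φ, hΦ, hcont, -, -⟩ := exists_isFlowMap_truncFlowAction B hsm N
  exact ⟨Φ, hΦ, fun t => (hcont.comp (continuous_const.prodMk continuous_id)).measurable⟩

/-! ## §4. The expressivity barrier: a law with long-range correlations is dual-norm far from the
order-`N` flow proposal, every volume -/

section Barrier

/-- Three-term covariance estimate with APPROXIMATE factorisation of the comparison law: if the second
moments are `εab`-close, the first moments `εa`- and `εb`-close, `|α'| ≤ a`, `|β| ≤ b`, and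
`|m' - α'β'| ≤ η`, then `|m - αβ| ≤ 3εab + η`. [folklore] -/
theorem abs_sub_mul_le_three_add {m α β m' α' β' ε η a b : ℝ} (hm : |m - m'| ≤ ε * (a * b))
    (hα : |α - α'| ≤ ε * a) (hβ : |β - β'| ≤ ε * b) (hα' : |α'| ≤ a) (hβb : |β| ≤ b)
    (hfac : |m' - α' * β'| ≤ η) : |m - α * β| ≤ 3 * ε * (a * b) + η := by
  have h1 : |α' - α| ≤ ε * a := by rwa [abs_sub_comm] at hα
  have h2 : |β' - β| ≤ ε * b := by rwa [abs_sub_comm] at hβ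
  have t2 : |α'| * |β' - β| ≤ a * (ε * b) :=
    mul_le_mul hα' h2 (abs_nonneg _) ((abs_nonneg _).trans hα')
  have t3 : |α' - α| * |β| ≤ (ε * a) * b :=
    mul_le_mul h1 hβb (abs_nonneg _) ((abs_nonneg _).trans h1)
  have e : m - α * β = (m - m') + (m' - α' * β') + (α' * (β' - β) + (α' - α) * β) := by ring
  rw [e]
  have s1 := abs_add_le ((m - m') + (m' - α' * β')) (α' * (β' - β) + (α' - α) * β)
  have s0 := abs_add_le (m - m') (m' - α' * β')
  have s2 := abs_add_le (α' * (β' - β)) ((α' - α) * β)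
  rw [abs_mul, abs_mul] at s2
  linarith

variable [NeZero L]

/-- **EXPRESSIVITY BARRIER OF FIXED-ORDER FLOWS (dual-norm form), EVERY VOLUME.**  Let `π` be ANY
probability law on `SU(n)^E` (e.g. the target `π_β`) that is `ε`-close in the dual sense
(`IntegralClose`, `ε ≥ 2·TV`) to the order-`N` flow proposal `q_t = (Φ_t)_* D[V]` of a smooth solution
for `β·S_W` (`Φ_t` measurable, `t ∈ [0, T]`, `T ≥ 0`, `n ≠ 0`).  Then for every pair of bounded
measurable sup-Lipschitz observables `A` (`a`, `S`, `ℓ_A`) and `B` (`b`, `T'`, `ℓ_B`) whose plaquette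
balls of radius `2(N+1)·m` are disjoint:
`|Cov_π(A, B)| ≤ 3εab + 2(ℓ_A ε_m b + a ℓ_B ε_m)`, `ε_m = 2n e^{ct}(ct)^m/m!`, `c = coneRate d n B β T N`.
Contrapositively: a law whose connected correlator across read-set separation `m` exceeds the light-cone
tail is at dual-norm distance `≥ (|Cov_π(A,B)| - 2(ℓ_A b + a ℓ_B)ε_m)/(3ab)` from EVERY order-`N`
flow proposal at `(β, t ≤ T)`, whatever the volume — the exact sampler must supply the difference through
its Metropolis–Hastings correction. [ours; cf. Luscher2010Trivializing §4.1, §4.5(b)(c)] -/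
theorem truncatedFlow_abs_cov_target_le (hn : n ≠ 0) (B : SuBasis n) (β : ℝ) (N : ℕ) {T : ℝ}
    (hT : 0 ≤ T) {Sk : ℕ → AmbConfig d L n → ℝ} {c : ℕ → ℝ} (hsm : ∀ k, ContDiff ℝ ∞ (Sk k))
    (hser : IsLuscherSeries B (fun W => β * ambWilsonAction W) Sk c)
    {Φ : ℝ → GaugeConfig d L (Matrix.specialUnitaryGroup (Fin n) ℂ) →
      GaugeConfig d L (Matrix.specialUnitaryGroup (Fin n) ℂ)}
    (hΦ : IsFlowMap (fun t W => -linkGrad B (truncFlowAction Sk t N) W) Φ)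
    {t : ℝ} (ht : t ∈ Set.Icc 0 T) (hΦm : Measurable (Φ t)) (m : ℕ)
    (ν : Measure (GaugeConfig d L (Matrix.specialUnitaryGroup (Fin n) ℂ))) [IsProbabilityMeasure ν]
    {ε : ℝ} (hclose : IntegralClose ν
      ((trivialMeasure (Matrix.specialUnitaryGroup (Fin n) ℂ) d L).map (Φ t)) ε)
    {A Bo : GaugeConfig d L (Matrix.specialUnitaryGroup (Fin n) ℂ) → ℝ}
    (hAm : Measurable A) (hBm : Measurable Bo) {a b : ℝ} (hAa : ∀ U, |A U| ≤ a) (hBb : ∀ U, |Bo U| ≤ b)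
    {S T' : Set (Edge d L)} (hA : DependsOn A S) (hB : DependsOn Bo T') {ℓA ℓB : ℝ}
    (hAlip : ∀ (U U' : GaugeConfig d L (Matrix.specialUnitaryGroup (Fin n) ℂ)) (η : ℝ),
      (∀ e ∈ S, ‖coeConfig U e - coeConfig U' e‖ ≤ η) → |A U - A U'| ≤ ℓA * η)
    (hBlip : ∀ (U U' : GaugeConfig d L (Matrix.specialUnitaryGroup (Fin n) ℂ)) (η : ℝ),
      (∀ e ∈ T', ‖coeConfig U e - coeConfig U' e‖ ≤ η) → |Bo U - Bo U'| ≤ ℓB * η)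
    (hsep : ∀ e ∈ S, ∀ e' ∈ T',
      Disjoint (linkBall (2 * (N + 1) * m) e) (linkBall (2 * (N + 1) * m) e')) :
    |∫ U, A U * Bo U ∂ν - (∫ U, A U ∂ν) * ∫ U, Bo U ∂ν| ≤
      3 * ε * (a * b) +
        2 * (ℓA * (2 * n * Real.exp (coneRate d n B β T N * t) *
            (coneRate d n B β T N * t) ^ m / (m ! : ℝ)) * b +
          a * (ℓB * (2 * n * Real.exp (coneRate d n B β T N * t) *
            (coneRate d n B β T N * t) ^ m / (m ! : ℝ)))) := by
  set q := (trivialMeasure (Matrix.specialUnitaryGroup (Fin n) ℂ) d L).map (Φ t) with hq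
  haveI : IsProbabilityMeasure (trivialMeasure (Matrix.specialUnitaryGroup (Fin n) ℂ) d L) := by
    unfold trivialMeasure; infer_instance
  haveI : IsProbabilityMeasure q := Measure.isProbabilityMeasure_map hΦm.aemeasurable
  have x₀ : GaugeConfig d L (Matrix.specialUnitaryGroup (Fin n) ℂ) := fun _ => 1
  have ha : 0 ≤ a := (abs_nonneg _).trans (hAa x₀)
  have hb : 0 ≤ b := (abs_nonneg _).trans (hBb x₀)
  have hAB : ∀ x, |A x * Bo x| ≤ a * b := fun x => by
    rw [abs_mul]; exact mul_le_mul (hAa x) (hBb x) (abs_nonneg _) ha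
  have hmean : ∀ (μ : Measure (GaugeConfig d L (Matrix.specialUnitaryGroup (Fin n) ℂ)))
      [IsProbabilityMeasure μ] (f : GaugeConfig d L (Matrix.specialUnitaryGroup (Fin n) ℂ) → ℝ)
      (c : ℝ), (∀ x, |f x| ≤ c) → |∫ x, f x ∂μ| ≤ c := by
    intro μ _ f c hf
    have h := norm_integral_le_of_norm_le_const (μ := μ) (f := f) (C := c)
      (Filter.Eventually.of_forall fun x => by simpa [Real.norm_eq_abs] using hf x)
    simpa [Real.norm_eq_abs] using h
  have hfac := truncatedFlow_abs_cov_le hn B β N hT hsm hser hΦ ht hΦm m hAm hBm hAa hBb hA hB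
    hAlip hBlip hsep
  exact abs_sub_mul_le_three_add (hclose _ _ (hAm.mul hBm) (mul_nonneg ha hb) hAB)
    (hclose _ _ hAm ha hAa) (hclose _ _ hBm hb hBb) (hmean q A a hAa) (hmean ν Bo b hBb) hfac

end Barrier

/-! ## §5. Explicit receptive depth and explicit decorrelation separation (theory-1 row 84) -/

section Depth

variable [NeZero L]

/-- **EXPLICIT RECEPTIVE DEPTH.**  For `n ≠ 0`, `T ≥ 0`, `t ∈ [0, T]`, `ε > 0` and
`m := ⌈max(e²·ct, ct + log(2n/ε))⌉₊` (`c = coneRate d n B β T N`): the range-`2(N+1)·m` localization of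
`Φ_t` is within `ε` of `Φ_t` at every link and every input — a receptive depth of
`O(ct + log(n/ε))` read-hops of radius `2(N+1)`, INDEPENDENT OF THE VOLUME (the profile arithmetic is
theory-1's `LightCone.coneProfile_le_at_ceil_depth`). [ours] -/
theorem truncatedFlow_receptiveDepth (hn : n ≠ 0) (B : SuBasis n) (β : ℝ) (N : ℕ) {T : ℝ} (hT : 0 ≤ T)
    {Sk : ℕ → AmbConfig d L n → ℝ} {c : ℕ → ℝ} (hsm : ∀ k, ContDiff ℝ ∞ (Sk k))
    (hser : IsLuscherSeries B (fun W => β * ambWilsonAction W) Sk c)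
    {Φ : ℝ → GaugeConfig d L (Matrix.specialUnitaryGroup (Fin n) ℂ) →
      GaugeConfig d L (Matrix.specialUnitaryGroup (Fin n) ℂ)}
    (hΦ : IsFlowMap (fun t W => -linkGrad B (truncFlowAction Sk t N) W) Φ)
    (V₀ : GaugeConfig d L (Matrix.specialUnitaryGroup (Fin n) ℂ)) {t : ℝ} (ht : t ∈ Set.Icc 0 T)
    {ε : ℝ} (hε : 0 < ε) (V : GaugeConfig d L (Matrix.specialUnitaryGroup (Fin n) ℂ)) (e : Edge d L) :
    ‖coeConfig (Φ t V) e -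
        coeConfig (localize (2 * (N + 1))
          ⌈max (Real.exp 2 * (coneRate d n B β T N * t))
            (coneRate d n B β T N * t + Real.log (2 * n / ε))⌉₊ V₀ (Φ t) V) e‖ ≤ ε := by
  have hct : 0 ≤ coneRate d n B β T N * t := mul_nonneg (coneRate_nonneg d n B β hT N) ht.1
  have hδ : (0 : ℝ) ≤ 2 * n := by positivity
  exact (truncatedFlow_receptiveField hn B β N hT hsm hser hΦ V₀ _ V e t ht).trans
    (LightCone.coneProfile_le_at_ceil_depth hδ hct hε)

/-- **EXPLICIT DECORRELATION SEPARATION**: for `ε > 0` and `m := ⌈max(e²ct, ct + log(2n/ε))⌉₊`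
(`c = coneRate d n B β T N`), observables whose plaquette balls of radius `2(N+1)·m` are disjoint have
`|Cov_{q_t}(A,B)| ≤ 2(ℓ_A b + a ℓ_B)·ε` — the proposal law decorrelates to precision `ε` beyond
`O(ct + log(n/ε))` read-hops, every volume. [ours] -/
theorem truncatedFlow_abs_cov_le_of_depth (hn : n ≠ 0) (B : SuBasis n) (β : ℝ) (N : ℕ) {T : ℝ}
    (hT : 0 ≤ T) {Sk : ℕ → AmbConfig d L n → ℝ} {c : ℕ → ℝ} (hsm : ∀ k, ContDiff ℝ ∞ (Sk k))
    (hser : IsLuscherSeries B (fun W => β * ambWilsonAction W) Sk c)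
    {Φ : ℝ → GaugeConfig d L (Matrix.specialUnitaryGroup (Fin n) ℂ) →
      GaugeConfig d L (Matrix.specialUnitaryGroup (Fin n) ℂ)}
    (hΦ : IsFlowMap (fun t W => -linkGrad B (truncFlowAction Sk t N) W) Φ)
    {t : ℝ} (ht : t ∈ Set.Icc 0 T) (hΦm : Measurable (Φ t)) {ε : ℝ} (hε : 0 < ε)
    {A Bo : GaugeConfig d L (Matrix.specialUnitaryGroup (Fin n) ℂ) → ℝ}
    (hAm : Measurable A) (hBm : Measurable Bo) {a b : ℝ} (hAa : ∀ U, |A U| ≤ a) (hBb : ∀ U, |Bo U| ≤ b)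
    {S T' : Set (Edge d L)} (hA : DependsOn A S) (hB : DependsOn Bo T') {ℓA ℓB : ℝ} (hℓA : 0 ≤ ℓA)
    (hℓB : 0 ≤ ℓB)
    (hAlip : ∀ (U U' : GaugeConfig d L (Matrix.specialUnitaryGroup (Fin n) ℂ)) (η : ℝ),
      (∀ e ∈ S, ‖coeConfig U e - coeConfig U' e‖ ≤ η) → |A U - A U'| ≤ ℓA * η)
    (hBlip : ∀ (U U' : GaugeConfig d L (Matrix.specialUnitaryGroup (Fin n) ℂ)) (η : ℝ),
      (∀ e ∈ T', ‖coeConfig U e - coeConfig U' e‖ ≤ η) → |Bo U - Bo U'| ≤ ℓB * η)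
    (hsep : ∀ e ∈ S, ∀ e' ∈ T',
      Disjoint
        (linkBall (2 * (N + 1) * ⌈max (Real.exp 2 * (coneRate d n B β T N * t))
          (coneRate d n B β T N * t + Real.log (2 * n / ε))⌉₊) e)
        (linkBall (2 * (N + 1) * ⌈max (Real.exp 2 * (coneRate d n B β T N * t))
          (coneRate d n B β T N * t + Real.log (2 * n / ε))⌉₊) e')) :
    |∫ U, A U * Bo U ∂(trivialMeasure (Matrix.specialUnitaryGroup (Fin n) ℂ) d L).map (Φ t) -
        (∫ U, A U ∂(trivialMeasure (Matrix.specialUnitaryGroup (Fin n) ℂ) d L).map (Φ t)) *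
          ∫ U, Bo U ∂(trivialMeasure (Matrix.specialUnitaryGroup (Fin n) ℂ) d L).map (Φ t)| ≤
      2 * (ℓA * ε * b + a * (ℓB * ε)) := by
  have x₀ : GaugeConfig d L (Matrix.specialUnitaryGroup (Fin n) ℂ) := fun _ => 1
  have ha : 0 ≤ a := (abs_nonneg _).trans (hAa x₀)
  have hb : 0 ≤ b := (abs_nonneg _).trans (hBb x₀)
  have hct : 0 ≤ coneRate d n B β T N * t := mul_nonneg (coneRate_nonneg d n B β hT N) ht.1
  have hδ : (0 : ℝ) ≤ 2 * n := by positivity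
  have hprof := LightCone.coneProfile_le_at_ceil_depth hδ hct hε
  refine (truncatedFlow_abs_cov_le hn B β N hT hsm hser hΦ ht hΦm _ hAm hBm hAa hBb hA hB hAlip hBlip
    hsep).trans ?_
  have h1 : ℓA * (2 * n * Real.exp (coneRate d n B β T N * t) *
      (coneRate d n B β T N * t) ^ ⌈max (Real.exp 2 * (coneRate d n B β T N * t))
        (coneRate d n B β T N * t + Real.log (2 * n / ε))⌉₊ /
      ((⌈max (Real.exp 2 * (coneRate d n B β T N * t))
        (coneRate d n B β T N * t + Real.log (2 * n / ε))⌉₊)! : ℝ)) * b ≤ ℓA * ε * b :=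
    mul_le_mul_of_nonneg_right (mul_le_mul_of_nonneg_left hprof hℓA) hb
  have h2 : a * (ℓB * (2 * n * Real.exp (coneRate d n B β T N * t) *
      (coneRate d n B β T N * t) ^ ⌈max (Real.exp 2 * (coneRate d n B β T N * t))
        (coneRate d n B β T N * t + Real.log (2 * n / ε))⌉₊ /
      ((⌈max (Real.exp 2 * (coneRate d n B β T N * t))
        (coneRate d n B β T N * t + Real.log (2 * n / ε))⌉₊)! : ℝ))) ≤ a * (ℓB * ε) :=
    mul_le_mul_of_nonneg_left (mul_le_mul_of_nonneg_left hprof hℓB) ha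
  linarith

end Depth

end Summit.Ventures.LatticeQCDFlow.TrivializingMaps

end
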